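import Literature.MathematicalPhysics.QuantumFieldTheory.Balaban1983to89.B2Prop31PrintedRestrictions
import Literature.MathematicalPhysics.QuantumFieldTheory.Balaban1983to89.B2Lemma23HiggsLattice

/-!
# `Balaban1983to89.B2Prop31MinimizerFamily` — [Balaban1982Higgs2] Proposition 3.1 (3.26) p. 589 for the §3 field `Ã^ε` of
(3.2)–(3.4) WHOSE MINIMIZERS ARE THE PRINTED ONES (3.3) `A^{(k),ε} = a_k(Lᵏε)^{−2}ζ^{(k)}G^ε_kQ*_kA_k` (r14's `B2Lemma23HiggsLattice.cutMin`
on the (Higgs)₂,₃ carrier) AND WHOSE RESTRICTIONS ARE THE PRINTED (2.55) ON THE BLOCK FIELDS `A_k` (sup bound and integrated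
variation on the `Λ₋₁`-regions), (2.17) and (2.55)₄ — the conclusions (2.59)_k/(2.60)_k of Lemma 2.3, which p23 g10's
head-of-record family `B2Prop31PrintedRestrictions.printedP31Fam` carries AS INPUTS (its HONEST SCOPE (i); r14 SECONDREAD-B2 v24
RULING-2 (b)/(4)), are here DERIVED (`restricted_toRMultiP`) from r14 g11's `lemma23_higgsLattice` (p312208) with explicit O(1)'s
`c₃ = C₁(r₁ + r₂)c_q + C₂c_{A1} + μ₀²c_{A1}/a_∞`, `c₅ = C₁(r₁ + r₂)c_q + C₂c_{A1}` and the printed largeness *"R > R₀"* of (2.7) (`R ≥ 2/δ`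
makes `e^{−δr(Lᵏε)/2} ≤ Lᵏε`); conclusion **`prop31Printed_minimizers`**: `∃ R₀ c₃ c₅ ∀ Q (Q.R ≥ R₀) … B2.Prop31Printed Q (minP31Fam Q Γ m²)`

statement-level skeleton of published theorems with citation tags; proofs where landed; nothing here is a claim about the Yang–Mills mass gap

CITATION HEADER.  T. Bałaban, *(Higgs)₂,₃ quantum fields in a finite volume. II. An upper bound*, Commun. Math. Phys. **86**
(1982) 555–594 [Balaban1982Higgs2] (PDF held `paper:balaban1982-cmp86-higgs23-ii`, journal page = PDF page + 554; pp. 557–558, 566,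
569–571, 583, 589 on the ×2 renders `run/shared/lean/pub/pub-balaban/b2b-balaban-ref1/pages/1982-cmp86-higgs23-II/…-p003/p004/p012/
p015/p016/p017/p029/p035-x2.png`); part I [Balaban1982Higgs1] (1.22)–(1.23) p. 607, (2.15) p. 609.  Cell `lit-balaban` (HOME
`run/shared/lean/pub/lit-balaban/`), Phase-2 proof seat **p23** gen 11 (unit `lit-balaban-p23-g11`; TAKING line HOME/STATUS.md
2026-08-22T01:20:31Z; r02 g9 01:06Z: *"the derivation of your `restricted` (2.59)_k/(2.60)_k from (2.55)-type block-field restrictions is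
now open as a p23-lane successor (RULING-2 item (4))"*).  SKELETON rows **B2.Prop3.1** (decl of record `B2.Prop31Printed`, owner r02, head
`proved p310287 · …`), **B2.Eq3.29**, **B2.Eq3.1-3.10** ((3.2)–(3.4)); second reader r14, referee ref-4.  USED BY NAME, NOTHING RESTATED:
r14 g11 `B2Lemma23HiggsLattice.{cutMin, lemma23_higgsLattice}` (p312208: Lemma 2.3 for the actual (3.3) minimizer on the carrier, zero
external field = the vector-field case of part I p. 608, torus sub-family `B1Eq211ZeroFieldTorus.Shape`); p23 g10
`B2Prop31PrintedRestrictions.{RMultiP, RMultiP.restricted, RMultiP.field, printedP31Fam, prop31Printed_thresholds, ineq329Printed_thresholds}`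
(p310287) and `B2Prop31Thresholds.{Consts, Consts.Valid, thr259, thr260, thr217, thrφ, SmallEps, one_le_u, pFn_nonneg'}` (p309542);
`B2Eq32FieldRegularity.field32` (p309492); the typer's `B3MultiscaleFields.{toSite, ofSite, zeroCharge}`, `HiggsLattice`, b2b's `B2.{Params,
pFn, rFn, Prop31Printed, Ineq329Printed}`, `B1.{aSeq, ainf_lt_aSeq}`.

ERRATUM (v1.1, p23 gen 12, 2026-08-22).  The carrier `RMultiM` below asks the four (2.44) clauses of the cut-off data `ζ^{(k)}`
(`ζ_abs`, `ζ_supp`, `ζ_one`, `ζ_lip`) at EVERY `k : ℕ`, whereas print defines `ζ^{(k)}` only for the steps `1 ≤ k ≤ K` (where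
`Lᵏε ≤ ε₀ ≤ 1` and `r(Lᵏε) ≥ R`).  Above the stopping scale the radius `r(Lᵏε) = R(1 + log(Lᵏε)⁻¹)^r` is meaningless (e.g. `= 0`
for `Lᵏε > e` at `r = 3/2`: `B2Prop31MinimizerFamilyK.rFn_three_halves_eq_zero`) and the clauses can be UNSATISFIABLE
(`B2Prop31MinimizerFamilyK.no_cutoff244_of_radius_lt_one`), so this family is THINNER than the print's (for `r = 3/2` it has no
instance on any torus with a side `2L_μ > eL`).  The theorems of this file are correct but quantify over too few instances; the
CORRECTED carrier `B2Prop31MinimizerFamilyK.RMultiMK` (p315587; clauses for `1 ≤ k ≤ K` only, `RMultiM.toK` embeds this family,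
`minP31Fam i = minP31FamK i.toK`) with its theorems `prop31Printed_minimizersK` / `ineq329Printed_minimizersK` supersedes
`prop31Printed_minimizers` / `ineq329Printed_minimizers` below, and `B2Prop31MinimizerWitness` (p315976) gives non-vacuity at `K = 1`
with a non-zero field.  No declaration of v1 is changed (one cite locator corrected: (2.97) is on p. 576; v1.2: the (2.7)/(2.8)
quotes made verbatim, referee ref-4 S-B2-g34-1).

WHAT IS PRINTED.  (3.3) p. 583: *"A^{(k),ε} = a_k(Lᵏε)^{−2}ζ^{(k)}G^ε_kQ*_kA_k"*; (2.44) p. 566: *"ζ^{(k)}(x, y) … is "smooth" with respect to x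
in the sense that |(∂^η_xζ^{(k)})(b, y)| ≦ 1, supp ζ^{(k)}(·, y) is contained in the set {x ∈ T_η : |x − y| < r(Lᵏε) − 2M} and ζ^{(k)}(x, y)
= 1 if |x − y| ≦ ½r(Lᵏε)"*; (2.7) p. 558: *"… less than r(ε) = R(1 + log ε⁻¹)^r. The numbers r, R satisfy r > 1, R > R₀ (R₀ occurs
in the formulation of Proposition I.2.1)."* (v1.2: verbatim, ref-4 S-B2-g34-1); (2.55) p. 570 [PDF 16]: *"|(∂A)(b)| ≦ c₁p(L^{k−1}ε), |A(x)| ≦ (c₁/(μ₀L^{k−1}ε))p(L^{k−1}ε) …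
for x ∈ Λ₋₁^{(k−1)′}, b ⊂ Λ₋₁^{(k−1)′}"*; Lemma 2.3 p. 571: *"Under the restrictions (2.55), we have A^{(k)}(x) = A(y) + O(p(Lᵏε)) …,
x ∈ Bᵏ(y), y ∈ Λ₂^{(k−1)′}, (2.59) (∂^η_μA^{(k)})(x) = O(p(Lᵏε)), x ∈ Bᵏ(Λ₂^{(k−1)′}). (2.60)"*; (2.8) p. 558 (the regions `Λ_i` are
`r(ε)`-separated: *"Λ_{i+1}ᶜ is the sum of all large blocks of T₁ with distances from the set Λ_iᶜ less or equal r(ε)"*, verbatim,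
v1.2); Prop. 3.1 p. 589: *"… satisfying the restrictions
given by the characteristic functions in (3.21) …"* (the `χ_k` of (3.21) = (2.55) at each scale).

THE DERIVATION (§2–§4).  In physical units with `s = Lᵏε` (the (I.1.22)–(1.23) dictionary of `B2Prop31Thresholds`): (2.55)₂ reads
`‖A_k(y′)‖ ≤ c_{A1}·s^{−d/2}p(s)` (`c_{A1} ↤ c₁/μ₀`; `thrA`), (2.55)₁ integrated along lattice paths reads `‖A_k(y′) − A_k(y)‖ ≤
c_q·s^{−(d−2)/2}p(s)·(r₁ + r₂|y − y′|)` (`thrQ`; p23 g4/r14's reading).  r14's Lemma 2.3 gives (2.59) `≤ C₁(r₁ + r₂)q + C₂e^{−δρ₁}t_A +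
(μ₀²s²/(a_k + μ₀²s²))t_A` and (2.60) `≤ L^{−k}(C₁(r₁ + r₂)q + C₂e^{−δρ₁}t_A)`, with the plateau radius `ρ₁ = ½r(s) = ½R(1 + log s⁻¹)^r`:
for `R ≥ 2/δ`, `r ≥ 1`, `s ≤ 1`: `δρ₁ ≥ 1 + log s⁻¹`, so `e^{−δρ₁} ≤ s` and `e^{−δρ₁}t_A ≤ c_{A1}·s^{−(d−2)/2}p(s)`; `μ₀²s²/(a_k + μ₀²s²) ≤
μ₀²s²/a_∞` (`a_k > a_∞ = a(1 − L⁻²)`) so the third term is `≤ (μ₀²c_{A1}/a_∞)s^{−(d−2)/2}p(s)`; and `L^{−k} = ε/s` turns `s^{−(d−2)/2}` into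
`ε·s^{−d/2}`.  Hence (2.59) `≤ thr259` with `c₃ = C₁(r₁ + r₂)c_q + C₂c_{A1} + μ₀²c_{A1}/a_∞` and (2.60) `≤ thr260` with `c₅ = C₁(r₁ + r₂)c_q + C₂c_{A1}`
— the gen-10 thresholds; then `B2Prop31PrintedRestrictions` applies verbatim.

WHAT THIS MODULE PROVES (kernel-checked, 0 `sorry`, standard axioms; definitions with bodies: the constants record `MinConsts` and its
derived `toConsts`/`c3Of`/`c5Of`/`thrA`/`thrQ`, the hypothesis SHAPE `Lemma23Bounds` (= the body of r14's `lemma23_higgsLattice` at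
`N = d`, INHABITED by `exists_lemma23Bounds` — not a fact), the carrier `RMultiM` with its DERIVED minimizers `RMultiM.A`, field
`RMultiM.field`, the map `toRMultiP`, the thresholds `thr217M`/`thrφM`, the predicate `restrictedM` and the families `minP31Fam`, `min329Fam`).
 §1 constants and thresholds; §2 the arithmetic `exp_neg_delta_rho_le` (`e^{−δr(s)/2} ≤ s`), `bound259_le_thr259`, `bound260_le_thr260`;
 §3 `Lemma23Bounds`, `exists_lemma23Bounds`, **`lemma23_thresholds`** ((2.59)/(2.60) in the gen-10 threshold shape for ONE level, any
    regions `Λ₂ ⊆ Λ₁` with the nbhd property, from (2.55) on `Λ₁`);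
 §4 `RMultiM`, `RMultiM.A` (:= (3.3)), `toRMultiP`, `restrictedM`, **`restricted_toRMultiP`** (`restrictedM ⇒ RMultiP.restricted` of the
    image, all six conjuncts: (2.59)_k, (2.60)_k on `Bᵏ(Λ_k)`, the slice conjuncts at level `k + 1`, (2.17), (2.55)₄);
 §5 `minP31Fam`, `min329Fam`, **`prop31Printed_minimizers`**, **`ineq329Printed_minimizers`**.
HONEST SCOPE.  (i) (2.55)₁ enters in the INTEGRATED reading (variation modulus `q(r₁ + r₂|y − y′|)` on the regions, as in p23 g4
`B2Lemma23Proof`, p23 g6 `B2Lemma23Torus`, r14 g11), (2.55)₂ as the sup bound; both in physical units at the scale `p(Lᵏε)` (the printed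
`p(L^{k−1}ε) ≤ (1 + log L)ᵖp(Lᵏε)` absorbed in the O(1)'s — gen-10 READING (vii)); the O(1)'s `c_{A1} (= c₁/μ₀), c_q, r₁, r₂` are parameters.
(ii) The REGIONS are data with printed-shape standing hypotheses: per level `Λ₂-region ⊆ Λ₁-region ⊂ T⁽ᵏ⁾` with `Λ₅⁽ᵏ⁻¹⁾′ ⊆ Λ₂-region`
(print: `Λ₅ ⊂ Λ₂`), the `θ_{k+1}`-slice inside `Bᵏ⁺¹(Λ₂-region of level k+1)` (print: supp θ_{k+1} within `< M` of `Bᵏ(Λ₂⁽ᵏ⁾)` — our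
`Λ₂`-region is any region carrying (2.59), cf. (2.97)–(2.98) *"on Bᵏ(Λ₁⁽ᵏ⁾)"*), and the range of `ζ^{(k)}` (+1) around `Bᵏ(Λ₂-region)` inside
the `Λ₁`-region where (2.55) holds (print: the `Λ_i` are `r`-separated, (2.8)) — READINGS, recorded, not derived from (2.7)–(2.8).
(iii) The cut-offs `ζ^{(k)}` are data with (2.44) in r14's block-label currency: support radius `r(Lᵏε)` (print: `< r(Lᵏε) − 2M`, weaker
here), plateau `½r(Lᵏε)`, `|ζ| ≤ 1`, Lipschitz `L^{−k}` per fine step.  (iv) Zero external field in `G^ε_k`, `Q_k^*` (= the vector-field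
case, part I p. 608) and the torus sub-family `M·L′_μ = Lᵐ`, `L` odd (r14's/p14's scope); `d = 2, 3`.  (v) The constants: `R₀ = 2/δ`,
`c₃`, `c₅` depend on `(d, L, a, μ₀², ε₀)` through r14's `(δ, C₁, C₂)` (existential, from p14's decay bounds) and on the O(1)'s; the smallness
*"e(Lᵏε) sufficiently small"* is gen-10's `SmallEps` evaluated at the DERIVED constants (a condition on `e` given everything else);
`γ₀`, `κ₀ < 2 − d/2` as in gen 10 (G-B2-07 (ix)).  (vi) (2.17) and (2.55)₄ stay printed restrictions (they ARE restrictions on the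
block fields / `Φ`).  (vii) Non-vacuity: instances with `K = 0` exist trivially (all restrictions vacuous); for `K ≥ 1` the cut-offs `ζ^{(k)}` with
the four (2.44) properties must be supplied — print builds them from a smooth partition of unity on the `Lᵏε`-lattice (p. 566); that
construction is NOT formalized here (gen 10's `exists_restricted_ne_zero` pattern does not need it).  (viii) No row head changes are
claimed (owner r02).  Nothing here is summit progress.
-/

noncomputable section

open Finset Real
open scoped BigOperators

namespace Literature.MathematicalPhysics.QuantumFieldTheory.Balaban1983to89.B2Prop31MinimizerFamily

open Literature.MathematicalPhysics.QuantumFieldTheory.Balaban1983to89.HiggsLattice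
open Literature.MathematicalPhysics.QuantumFieldTheory.Balaban1983to89.HiggsAveraging
open Literature.MathematicalPhysics.QuantumFieldTheory.Balaban1983to89.HiggsCovariance
open Literature.MathematicalPhysics.QuantumFieldTheory.Balaban1983to89.HiggsCovariancePos
open Literature.MathematicalPhysics.QuantumFieldTheory.Balaban1983to89.B2Eq337ScalarIntegration
open Literature.MathematicalPhysics.QuantumFieldTheory.Balaban1983to89.B2Eq325ConcreteSchur
open Literature.MathematicalPhysics.QuantumFieldTheory.Balaban1983to89.B2Ineq327ConcreteNeumann
open Literature.MathematicalPhysics.QuantumFieldTheory.Balaban1983to89.B2Eq328ConcretePieces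
open Literature.MathematicalPhysics.QuantumFieldTheory.Balaban1983to89.B2Eq328DeltaK
open Literature.MathematicalPhysics.QuantumFieldTheory.Balaban1983to89.B2Ineq329ZeroAveraging
open Literature.MathematicalPhysics.QuantumFieldTheory.Balaban1983to89.B2Prop31ZeroFieldConcrete
open Literature.MathematicalPhysics.QuantumFieldTheory.Balaban1983to89.B2Eq255Concrete (barA barA_zero)
open Literature.MathematicalPhysics.QuantumFieldTheory.Balaban1983to89.B2Ineq329RegularField
open Literature.MathematicalPhysics.QuantumFieldTheory.Balaban1983to89.B2Eq324NestedRegions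
open Literature.MathematicalPhysics.QuantumFieldTheory.Balaban1983to89.B2Eq32FieldRegularity
open Literature.MathematicalPhysics.QuantumFieldTheory.Balaban1983to89.B2Prop31Thresholds
open Literature.MathematicalPhysics.QuantumFieldTheory.Balaban1983to89.B2Prop31PrintedRestrictions
open Literature.MathematicalPhysics.QuantumFieldTheory.Balaban1983to89.B3MultiscaleFields (toSite ofSite zeroCharge)
open Literature.MathematicalPhysics.QuantumFieldTheory.Balaban1983to89.B2Lemma23HiggsLattice (cutMin lemma23_higgsLattice)
open Literature.MathematicalPhysics.QuantumFieldTheory.Balaban1983to89.B1Eq211ZeroFieldTorus (Shape)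
open B2Sect2BDensities (Nested)

/-! ## §1 The constants of the printed restrictions (2.55)/(2.17)/(2.55)₄ and the derived gen-10 constants -/

/-- The constants of the family: the couplings `e` ((I.1.7)), `λ` ((2.5)), `b₀, p` of `p(ε)` (p. 557), the vector-field mass `μ₀²`
((I.1.11)), the O(1)'s `c₄` of (2.17)/(2.97), `c_θ` of `|∂θ| ≤ O(1)` (p. 567), `c_φ` of (2.55)₄/(3.15)₂, the stopping scale `ε₀` (p. 582),
and the O(1)'s of (2.55) on the block vector fields in physical units: `c_{A1}` (sup, *"|A(x)| ≦ (c₁/(μ₀L^{k−1}ε))p"* ↦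
`‖A_k(y)‖ ≤ c_{A1}·s^{−d/2}p(s)`) and `c_q, r₁, r₂` (integrated (2.55)₁: `‖A_k(y′) − A_k(y)‖ ≤ c_q·s^{−(d−2)/2}p(s)·(r₁ + r₂|y − y′|)`).
[cite: Balaban1982Higgs2, (2.55) p.570, (2.17) p.560, (2.5) p.557, p.567, p.582] -/
structure MinConsts where
  e : ℝ
  lam : ℝ
  b₀ : ℝ
  p : ℝ
  μ0sq : ℝ
  c₄ : ℝ
  cθ : ℝ
  cφ : ℝ
  ε₀ : ℝ
  cA1 : ℝ
  cq : ℝ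
  r₁ : ℝ
  r₂ : ℝ

namespace MinConsts

/-- The printed ranges (`λ > 0`, `b₀ ≥ 0`, `p > 0`, `μ₀² > 0`, O(1)'s `≥ 0`, `0 < ε₀ ≤ 1`). [cite: Balaban1982Higgs2, pp.557, 570, 582] -/
structure Valid (Γ : MinConsts) : Prop where
  lam_pos : 0 < Γ.lam
  b₀_nonneg : 0 ≤ Γ.b₀
  p_pos : 0 < Γ.p
  μ0sq_pos : 0 < Γ.μ0sq
  c₄_nonneg : 0 ≤ Γ.c₄
  cθ_nonneg : 0 ≤ Γ.cθ
  cφ_nonneg : 0 ≤ Γ.cφ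
  ε₀_pos : 0 < Γ.ε₀
  ε₀_le_one : Γ.ε₀ ≤ 1
  cA1_nonneg : 0 ≤ Γ.cA1
  cq_nonneg : 0 ≤ Γ.cq
  r₁_nonneg : 0 ≤ Γ.r₁
  r₂_nonneg : 0 ≤ Γ.r₂

variable (Γ : MinConsts)

/-- The gen-10 constants record with the (2.59)/(2.60) O(1)'s `c₃`, `c₅` SUPPLIED (here: derived). [cite: Balaban1982Higgs2, (2.59)–(2.60) p.571] -/
def toConsts (c₃ c₅ : ℝ) : B2Prop31Thresholds.Consts :=
  { e := Γ.e, lam := Γ.lam, b₀ := Γ.b₀, p := Γ.p, c₃ := c₃, c₄ := Γ.c₄, c₅ := c₅, cθ := Γ.cθ, cφ := Γ.cφ, ε₀ := Γ.ε₀ }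

/-- Validity transfers (`c₃, c₅ ≥ 0`). [cite: Balaban1982Higgs2, p.571] -/
theorem toConsts_valid {Γ : MinConsts} (h : Γ.Valid) {c₃ c₅ : ℝ} (hc₃ : 0 ≤ c₃) (hc₅ : 0 ≤ c₅) : (Γ.toConsts c₃ c₅).Valid :=
  { lam_pos := h.lam_pos, b₀_nonneg := h.b₀_nonneg, p_pos := h.p_pos, c₃_nonneg := hc₃, c₄_nonneg := h.c₄_nonneg,
    c₅_nonneg := hc₅, cθ_nonneg := h.cθ_nonneg, cφ_nonneg := h.cφ_nonneg, ε₀_pos := h.ε₀_pos, ε₀_le_one := h.ε₀_le_one }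

/-- (2.55)₂ / (3.15)₁ in physical units: `‖A_k(y)‖ ≤ c_{A1}·s^{−d/2}·p(s)`, `s = Lᵏε` (print, unit lattice: `(c₁/(μ₀Lᵏε))p(Lᵏε)`, times
`s^{−(d−2)/2}` by (I.1.22); `c_{A1} ↤ c₁/μ₀`). [cite: Balaban1982Higgs2, (2.55) p.570, (3.15) p.586] [cite: Balaban1982Higgs1, (1.22) p.607] -/
def thrA (d : ℕ) (s : ℝ) : ℝ := Γ.cA1 * s ^ (-(d : ℝ) / 2) * B2.pFn Γ.b₀ Γ.p s

/-- (2.55)₁ integrated, physical units: `‖A_k(y′) − A_k(y)‖ ≤ c_q·s^{−(d−2)/2}p(s)·(r₁ + r₂|y − y′|)` (a difference of values of a field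
whose coarse derivative is `≤ c₁p` along a lattice path). [cite: Balaban1982Higgs2, (2.55) p.570] [cite: Balaban1982Higgs1, (1.22) p.607] -/
def thrQ (d : ℕ) (s : ℝ) : ℝ := Γ.cq * s ^ (-((d : ℝ) - 2) / 2) * B2.pFn Γ.b₀ Γ.p s

/-- The DERIVED O(1) of (2.59): `c₃ = C₁(r₁ + r₂)c_q + C₂c_{A1} + μ₀²c_{A1}/a_∞`, `a_∞ = a(1 − L⁻²)` ((I.2.15)).
[cite: Balaban1982Higgs2, (2.59) p.571] [cite: Balaban1982Higgs1, (2.15) p.609] -/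
def c3Of (a : ℝ) (L : ℕ) (C₁ C₂ : ℝ) : ℝ :=
  C₁ * (Γ.r₁ + Γ.r₂) * Γ.cq + C₂ * Γ.cA1 + Γ.μ0sq * Γ.cA1 / (a * (1 - ((L : ℝ) ^ 2)⁻¹))

/-- The DERIVED O(1) of (2.60): `c₅ = C₁(r₁ + r₂)c_q + C₂c_{A1}`. [cite: Balaban1982Higgs2, (2.60) p.571] -/
def c5Of (C₁ C₂ : ℝ) : ℝ := C₁ * (Γ.r₁ + Γ.r₂) * Γ.cq + C₂ * Γ.cA1

/-- `c₅ ≥ 0`. [cite: Balaban1982Higgs2, (2.60) p.571] -/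
theorem c5Of_nonneg {Γ : MinConsts} (h : Γ.Valid) {C₁ C₂ : ℝ} (hC₁ : 0 ≤ C₁) (hC₂ : 0 ≤ C₂) : 0 ≤ Γ.c5Of C₁ C₂ := by
  unfold c5Of
  have := h.cA1_nonneg; have := h.cq_nonneg; have := h.r₁_nonneg; have := h.r₂_nonneg
  positivity

/-- `c₃ ≥ 0` (a > 0, L > 1). [cite: Balaban1982Higgs2, (2.59) p.571] -/
theorem c3Of_nonneg {Γ : MinConsts} (h : Γ.Valid) {a : ℝ} (ha : 0 < a) {L : ℕ} (hL : 1 < L) {C₁ C₂ : ℝ} (hC₁ : 0 ≤ C₁)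
    (hC₂ : 0 ≤ C₂) : 0 ≤ Γ.c3Of a L C₁ C₂ := by
  unfold c3Of
  have hLr : (1 : ℝ) < L := by exact_mod_cast hL
  have hainf : 0 < a * (1 - ((L : ℝ) ^ 2)⁻¹) := by
    have hL2 : 1 < (L : ℝ) ^ 2 := by nlinarith
    have : ((L : ℝ) ^ 2)⁻¹ < 1 := inv_lt_one_of_one_lt₀ hL2
    exact mul_pos ha (by linarith)
  have hcA := h.cA1_nonneg; have hcq := h.cq_nonneg; have hr₁ := h.r₁_nonneg; have hr₂ := h.r₂_nonneg
  have hμ := h.μ0sq_pos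
  have h1 : 0 ≤ C₁ * (Γ.r₁ + Γ.r₂) * Γ.cq := by positivity
  have h2 : 0 ≤ C₂ * Γ.cA1 := mul_nonneg hC₂ hcA
  have h3 : 0 ≤ Γ.μ0sq * Γ.cA1 / (a * (1 - ((L : ℝ) ^ 2)⁻¹)) := div_nonneg (mul_nonneg hμ.le hcA) hainf.le
  linarith

/-- The restriction (2.17)/(2.97) in physical units, `|A_{k+1}(y′)_μ − A_k(y)_μ| ≤ c₄·s^{−(d−2)/2}·p(s)` (= gen 10's `thr217`,
which does not read `c₃`, `c₅`: `thr217_toConsts`). [cite: Balaban1982Higgs2, (2.17) p.560, (2.97) p.576] -/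
def thr217M (d : ℕ) (s : ℝ) : ℝ := Γ.c₄ * s ^ (-((d : ℝ) - 2) / 2) * B2.pFn Γ.b₀ Γ.p s

/-- (2.55)₄/(3.15)₂ in physical units, `‖φ_k(y)‖ ≤ c_φ·λ^{−1/4}·s^{−d/4}·p(s)` (= gen 10's `thrφ`: `thrφ_toConsts`).
[cite: Balaban1982Higgs2, (2.55) p.570, (3.15) p.586] -/
def thrφM (d : ℕ) (s : ℝ) : ℝ := Γ.cφ * Γ.lam ^ (-(1 / 4 : ℝ)) * s ^ (-(d : ℝ) / 4) * B2.pFn Γ.b₀ Γ.p s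

/-- `thr217 (toConsts c₃ c₅) = thr217M` (definitional). [cite: Balaban1982Higgs2, (2.17) p.560] -/
theorem thr217_toConsts (c₃ c₅ : ℝ) (d : ℕ) (s : ℝ) : thr217 (Γ.toConsts c₃ c₅) d s = Γ.thr217M d s := rfl

/-- `thrφ (toConsts c₃ c₅) = thrφM` (definitional). [cite: Balaban1982Higgs2, (2.55) p.570] -/
theorem thrφ_toConsts (c₃ c₅ : ℝ) (d : ℕ) (s : ℝ) : thrφ (Γ.toConsts c₃ c₅) d s = Γ.thrφM d s := rfl

end MinConsts

/-! ## §2 The arithmetic: `e^{−δr(s)/2} ≤ s` for `R ≥ 2/δ`; the three terms of r14's (2.59)/(2.60) bounds against `thr259`/`thr260` -/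

section Arith

/-- **The printed largeness of `R` at work** ((2.7): *"The numbers r, R satisfy r > 1, R > R₀"*): for `0 < s ≤ 1`, `δ > 0`, `R ≥ 2/δ`,
`r ≥ 1`, the plateau radius `ρ₁ = ½r(s) = ½R(1 + log s⁻¹)^r` of (2.44) satisfies `e^{−δρ₁} ≤ s` (`δρ₁ ≥ 1 + log s⁻¹ ≥ −log s`).
[cite: Balaban1982Higgs2, (2.7) p.558, (2.44) p.566] -/
theorem exp_neg_delta_rho_le {s δ R r : ℝ} (hs : 0 < s) (hs1 : s ≤ 1) (hδ : 0 < δ) (hR : 2 / δ ≤ R) (hr : 1 ≤ r) :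
    Real.exp (-(δ * (B2.rFn R r s / 2))) ≤ s := by
  have hu : 1 ≤ 1 + Real.log s⁻¹ := one_le_u hs hs1
  have hur : 1 + Real.log s⁻¹ ≤ (1 + Real.log s⁻¹) ^ r := Real.self_le_rpow_of_one_le hu hr
  have h2 : 2 ≤ δ * R := by
    have h := mul_le_mul_of_nonneg_left hR hδ.le
    have h' : δ * (2 / δ) = 2 := by field_simp
    linarith
  have h4 : 0 ≤ (1 + Real.log s⁻¹) ^ r := le_trans (by linarith) hur
  have hkey : 1 + Real.log s⁻¹ ≤ δ * (B2.rFn R r s / 2) := by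
    unfold B2.rFn
    have h3 : δ * (R * (1 + Real.log s⁻¹) ^ r / 2) = (δ * R) / 2 * (1 + Real.log s⁻¹) ^ r := by ring
    rw [h3]
    nlinarith [mul_nonneg (by linarith : 0 ≤ δ * R / 2 - 1) h4]
  have hlog : Real.log s⁻¹ = -Real.log s := Real.log_inv s
  calc Real.exp (-(δ * (B2.rFn R r s / 2))) ≤ Real.exp (Real.log s) := by
        apply Real.exp_le_exp.2
        linarith
    _ = s := Real.exp_log hs

/-- `s·s^{−d/2} = s^{−(d−2)/2}` (`s > 0`). [cite: Balaban1982Higgs1, (1.22) p.607] -/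
theorem mul_rpow_neg_half (d : ℕ) {s : ℝ} (hs : 0 < s) : s * s ^ (-(d : ℝ) / 2) = s ^ (-((d : ℝ) - 2) / 2) := by
  have h : s ^ (-((d : ℝ) - 2) / 2) = s ^ ((1 : ℝ) + -(d : ℝ) / 2) := by congr 1; ring
  rw [h, Real.rpow_add hs, Real.rpow_one]

/-- `(ε/s)·s^{−(d−2)/2} = ε·s^{−d/2}` (`s > 0`): the fine-step factor `L^{−k} = ε/s` of (2.60). [cite: Balaban1982Higgs1, (1.23) p.607] -/
theorem div_mul_rpow_neg_half (d : ℕ) (ε : ℝ) {s : ℝ} (hs : 0 < s) :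
    ε / s * s ^ (-((d : ℝ) - 2) / 2) = ε * s ^ (-(d : ℝ) / 2) := by
  rw [← mul_rpow_neg_half d hs]
  have hs' : s ≠ 0 := hs.ne'
  calc ε / s * (s * s ^ (-(d : ℝ) / 2)) = (ε / s * s) * s ^ (-(d : ℝ) / 2) := by ring
    _ = ε * s ^ (-(d : ℝ) / 2) := by rw [div_mul_cancel₀ ε hs']

/-- **r14's (2.59) bound against the gen-10 threshold `thr259`**: with `q = thrQ(s)`, `t_A = thrA(s)`, a factor `E ≤ s` (:= `e^{−δρ₁}`),
`a_k > a_∞ = a(1 − L⁻²)`, `0 < s ≤ 1`: `C₁(r₁ + r₂)q + C₂E·t_A + (μ₀²s²/(a_k + μ₀²s²))t_A ≤ c₃·s^{−(d−2)/2}p(s)` with `c₃ = c3Of`.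
[cite: Balaban1982Higgs2, (2.59) p.571] [cite: Balaban1982Higgs1, (1.22) p.607, (2.15) p.609] -/
theorem bound259_le_thr259 {Γ : MinConsts} (hΓ : Γ.Valid) {a : ℝ} (ha : 0 < a) {L : ℕ} (hL : 1 < L) {C₁ C₂ E ak : ℝ}
    (hC₂ : 0 ≤ C₂) (d : ℕ) {s : ℝ} (hs : 0 < s) (hs1 : s ≤ 1) (hE : E ≤ s)
    (hak : a * (1 - ((L : ℝ) ^ 2)⁻¹) < ak) (c₅ : ℝ) :
    C₁ * (Γ.r₁ + Γ.r₂) * Γ.thrQ d s + C₂ * E * Γ.thrA d s + Γ.μ0sq * s ^ 2 / (ak + Γ.μ0sq * s ^ 2) * Γ.thrA d s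
      ≤ thr259 (Γ.toConsts (Γ.c3Of a L C₁ C₂) c₅) d s := by
  have hLr : (1 : ℝ) < L := by exact_mod_cast hL
  have hainf : 0 < a * (1 - ((L : ℝ) ^ 2)⁻¹) := by
    have hL2 : 1 < (L : ℝ) ^ 2 := by nlinarith
    have : ((L : ℝ) ^ 2)⁻¹ < 1 := inv_lt_one_of_one_lt₀ hL2
    exact mul_pos ha (by linarith)
  have hp : 0 ≤ B2.pFn Γ.b₀ Γ.p s :=
    pFn_nonneg' (Γ := Γ.toConsts 0 0) (MinConsts.toConsts_valid hΓ le_rfl le_rfl) hs hs1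
  have hcA := hΓ.cA1_nonneg
  have hμ := hΓ.μ0sq_pos
  have hsd : 0 ≤ s ^ (-(d : ℝ) / 2) := Real.rpow_nonneg hs.le _
  have hA0 : 0 ≤ Γ.thrA d s := by unfold MinConsts.thrA; positivity
  set X : ℝ := s ^ (-((d : ℝ) - 2) / 2) * B2.pFn Γ.b₀ Γ.p s with hX
  -- term 1: `C₁(r₁ + r₂)·thrQ = C₁(r₁ + r₂)c_q·X`
  have h1 : C₁ * (Γ.r₁ + Γ.r₂) * Γ.thrQ d s = C₁ * (Γ.r₁ + Γ.r₂) * Γ.cq * X := by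
    rw [hX]; unfold MinConsts.thrQ; ring
  -- term 2: `C₂E·thrA ≤ C₂s·c_{A1}s^{−d/2}p = C₂c_{A1}·X`
  have h2 : C₂ * E * Γ.thrA d s ≤ C₂ * Γ.cA1 * X := by
    calc C₂ * E * Γ.thrA d s ≤ C₂ * s * Γ.thrA d s := by gcongr
      _ = C₂ * Γ.cA1 * (s * s ^ (-(d : ℝ) / 2) * B2.pFn Γ.b₀ Γ.p s) := by unfold MinConsts.thrA; ring
      _ = C₂ * Γ.cA1 * X := by rw [mul_rpow_neg_half d hs, hX]
  -- term 3: `(μ₀²s²/(a_k + μ₀²s²))·thrA ≤ (μ₀²s²/a_∞)·c_{A1}s^{−d/2}p ≤ (μ₀²c_{A1}/a_∞)·X`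
  have h3 : Γ.μ0sq * s ^ 2 / (ak + Γ.μ0sq * s ^ 2) * Γ.thrA d s
      ≤ Γ.μ0sq * Γ.cA1 / (a * (1 - ((L : ℝ) ^ 2)⁻¹)) * X := by
    have hden : a * (1 - ((L : ℝ) ^ 2)⁻¹) ≤ ak + Γ.μ0sq * s ^ 2 := by nlinarith [sq_nonneg s]
    have hfrac : Γ.μ0sq * s ^ 2 / (ak + Γ.μ0sq * s ^ 2) ≤ Γ.μ0sq * s ^ 2 / (a * (1 - ((L : ℝ) ^ 2)⁻¹)) :=
      div_le_div_of_nonneg_left (by positivity) hainf hden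
    have hs2 : s ^ 2 * s ^ (-(d : ℝ) / 2) ≤ s ^ (-((d : ℝ) - 2) / 2) := by
      rw [← mul_rpow_neg_half d hs]
      have : s ^ 2 * s ^ (-(d : ℝ) / 2) = s * (s * s ^ (-(d : ℝ) / 2)) := by ring
      rw [this]
      exact mul_le_of_le_one_left (mul_nonneg hs.le hsd) hs1
    have hcoef : 0 ≤ Γ.μ0sq * Γ.cA1 / (a * (1 - ((L : ℝ) ^ 2)⁻¹)) := div_nonneg (mul_nonneg hμ.le hcA) hainf.le
    calc Γ.μ0sq * s ^ 2 / (ak + Γ.μ0sq * s ^ 2) * Γ.thrA d s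
        ≤ Γ.μ0sq * s ^ 2 / (a * (1 - ((L : ℝ) ^ 2)⁻¹)) * Γ.thrA d s := mul_le_mul_of_nonneg_right hfrac hA0
      _ = Γ.μ0sq * Γ.cA1 / (a * (1 - ((L : ℝ) ^ 2)⁻¹)) * ((s ^ 2 * s ^ (-(d : ℝ) / 2)) * B2.pFn Γ.b₀ Γ.p s) := by
          unfold MinConsts.thrA; ring
      _ ≤ Γ.μ0sq * Γ.cA1 / (a * (1 - ((L : ℝ) ^ 2)⁻¹)) * X := by
          rw [hX]
          exact mul_le_mul_of_nonneg_left (mul_le_mul_of_nonneg_right hs2 hp) hcoef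
  have hthr : thr259 (Γ.toConsts (Γ.c3Of a L C₁ C₂) c₅) d s = Γ.c3Of a L C₁ C₂ * X := by
    rw [hX]
    show Γ.c3Of a L C₁ C₂ * s ^ (-((d : ℝ) - 2) / 2) * B2.pFn Γ.b₀ Γ.p s = _
    ring
  rw [hthr, h1, MinConsts.c3Of]
  linarith [h2, h3]

/-- **r14's (2.60) bound against the gen-10 threshold `thr260`**: `ℓ⁻¹(C₁(r₁ + r₂)q + C₂E·t_A) ≤ c₅·ε·s^{−d/2}p(s) = thr260` with
`c₅ = c5Of`, `ℓ = Lᵏ`, `ℓε = s` (so `ℓ⁻¹ = ε/s`), `E ≤ s`. [cite: Balaban1982Higgs2, (2.60) p.571] [cite: Balaban1982Higgs1, (1.23) p.607] -/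
theorem bound260_le_thr260 {Γ : MinConsts} (hΓ : Γ.Valid) {C₁ C₂ E : ℝ} (hC₂ : 0 ≤ C₂) (d : ℕ) {ε s ℓ : ℝ}
    (hε : 0 ≤ ε) (hs : 0 < s) (hs1 : s ≤ 1) (hℓ : ℓ * ε = s) (hE : E ≤ s) (c₃ : ℝ) :
    ℓ⁻¹ * (C₁ * (Γ.r₁ + Γ.r₂) * Γ.thrQ d s + C₂ * E * Γ.thrA d s) ≤ thr260 (Γ.toConsts c₃ (Γ.c5Of C₁ C₂)) d ε s := by
  have hp : 0 ≤ B2.pFn Γ.b₀ Γ.p s :=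
    pFn_nonneg' (Γ := Γ.toConsts 0 0) (MinConsts.toConsts_valid hΓ le_rfl le_rfl) hs hs1
  have hcA := hΓ.cA1_nonneg
  have hA0 : 0 ≤ Γ.thrA d s := by unfold MinConsts.thrA; positivity
  set X : ℝ := s ^ (-((d : ℝ) - 2) / 2) * B2.pFn Γ.b₀ Γ.p s with hX
  have hℓpos : 0 < ℓ := by nlinarith
  have hℓinv : ℓ⁻¹ = ε / s := by
    rw [eq_div_iff hs.ne', ← hℓ, ← mul_assoc, inv_mul_cancel₀ hℓpos.ne', one_mul]
  have hinner : C₁ * (Γ.r₁ + Γ.r₂) * Γ.thrQ d s + C₂ * E * Γ.thrA d s ≤ Γ.c5Of C₁ C₂ * X := by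
    have h1 : C₁ * (Γ.r₁ + Γ.r₂) * Γ.thrQ d s = C₁ * (Γ.r₁ + Γ.r₂) * Γ.cq * X := by
      rw [hX]; unfold MinConsts.thrQ; ring
    have h2 : C₂ * E * Γ.thrA d s ≤ C₂ * Γ.cA1 * X := by
      calc C₂ * E * Γ.thrA d s ≤ C₂ * s * Γ.thrA d s := by gcongr
        _ = C₂ * Γ.cA1 * (s * s ^ (-(d : ℝ) / 2) * B2.pFn Γ.b₀ Γ.p s) := by unfold MinConsts.thrA; ring
        _ = C₂ * Γ.cA1 * X := by rw [mul_rpow_neg_half d hs, hX]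
    rw [h1, MinConsts.c5Of]
    linarith
  have hthr : thr260 (Γ.toConsts c₃ (Γ.c5Of C₁ C₂)) d ε s = ε / s * (Γ.c5Of C₁ C₂ * X) := by
    rw [hX]
    show Γ.c5Of C₁ C₂ * ε * s ^ (-(d : ℝ) / 2) * B2.pFn Γ.b₀ Γ.p s = _
    rw [← mul_rpow_neg_half d hs]
    have hs' : s ≠ 0 := hs.ne'
    calc Γ.c5Of C₁ C₂ * ε * s ^ (-(d : ℝ) / 2) * B2.pFn Γ.b₀ Γ.p s
        = (ε / s * s) * (Γ.c5Of C₁ C₂ * (s ^ (-(d : ℝ) / 2) * B2.pFn Γ.b₀ Γ.p s)) := by rw [div_mul_cancel₀ ε hs']; ring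
      _ = ε / s * (Γ.c5Of C₁ C₂ * (s * s ^ (-(d : ℝ) / 2) * B2.pFn Γ.b₀ Γ.p s)) := by ring
  rw [hthr, hℓinv]
  exact mul_le_mul_of_nonneg_left hinner (div_nonneg hε hs.le)

end Arith

/-! ## §3 Lemma 2.3 on the carrier in the gen-10 threshold shape, one level -/

/-- **The shape of r14's `lemma23_higgsLattice` at `N = d`** for fixed constants `(δ, C₁, C₂)`: Lemma 2.3 (2.59)/(2.60) for the (3.3)
minimizer `cutMin` on every torus of the sub-family with `P.d = d`, `P.L = L`, every coupling, level `1 ≤ k ≤ K` with `Lᵏε ≤ ε₀`,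
every (2.44)-cut-off, all regions `Λ₂ ⊆ Λ₁` with the nbhd property, every block field obeying (2.55) on `Λ₁` (a hypothesis SHAPE with
parameters, INHABITED by `exists_lemma23Bounds`; not a fact). [cite: Balaban1982Higgs2, Lemma 2.3 (2.59)–(2.60) p.571, (3.3) p.583] -/
def Lemma23Bounds (d L : ℕ) (a μ0sq ε₀ δ C₁ C₂ : ℝ) : Prop :=
  ∀ (P : HiggsLattice.Params) (_S : Shape P), P.d = d → P.L = L →
    ∀ (C : ChargeData d) {k : ℕ}, 1 ≤ k → k ≤ P.K → P.mesh k ≤ ε₀ →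
    ∀ (ζ : HiggsLattice.Site P 0 → HiggsLattice.Site P k → ℝ) (ρ ρ₁ : ℝ), 0 ≤ ρ₁ →
      (∀ x y', |ζ x y'| ≤ 1) →
      (∀ x y', ζ x y' ≠ 0 → (HiggsLattice.Site.tdist (blockIter k x) y' : ℝ) ≤ ρ) →
      (∀ x y', (HiggsLattice.Site.tdist (blockIter k x) y' : ℝ) ≤ ρ₁ → ζ x y' = 1) →
      (∀ (x : HiggsLattice.Site P 0) (ν : Fin P.d) (y' : HiggsLattice.Site P k), |ζ (x.shift ν) y' - ζ x y'| ≤ ((P.L : ℝ) ^ k)⁻¹) →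
    ∀ (Λ₁ Λ₂ : Finset (HiggsLattice.Site P k)), Λ₂ ⊆ Λ₁ →
      (∀ x y', blockIter k x ∈ Λ₂ → (HiggsLattice.Site.tdist (blockIter k x) y' : ℝ) ≤ ρ + 1 → y' ∈ Λ₁) →
    ∀ (A : HiggsLattice.ScalarField P k d) (tA q r₁ r₂ : ℝ), 0 ≤ q → 0 ≤ r₁ → 0 ≤ r₂ →
      (∀ y' ∈ Λ₁, ‖A y'‖ ≤ tA) →
      (∀ y ∈ Λ₂, ∀ y' ∈ Λ₁, ‖A y' - A y‖ ≤ q * (r₁ + r₂ * (HiggsLattice.Site.tdist y y' : ℝ))) →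
    ∀ (x : HiggsLattice.Site P 0), blockIter k x ∈ Λ₂ →
      ‖cutMin C μ0sq a k ζ A x - A (blockIter k x)‖ ≤
          C₁ * (r₁ + r₂) * q + C₂ * Real.exp (-(δ * ρ₁)) * tA
            + μ0sq * P.mesh k ^ 2 / (B1.aSeq a P.L k + μ0sq * P.mesh k ^ 2) * tA
      ∧ ∀ ν : Fin P.d, ‖cutMin C μ0sq a k ζ A (x.shift ν) - cutMin C μ0sq a k ζ A x‖ ≤
          ((P.L : ℝ) ^ k)⁻¹ * (C₁ * (r₁ + r₂) * q + C₂ * Real.exp (-(δ * ρ₁)) * tA)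

/-- **`Lemma23Bounds` IS INHABITED** — r14 g11's `lemma23_higgsLattice` (p312208) at `N = d`: for `d ≥ 1`, odd `L > 1`, `a > 0`, `μ₀² > 0`,
every `ε₀` there are `δ, C₁, C₂ > 0` with `Lemma23Bounds d L a μ₀² ε₀ δ C₁ C₂`. [cite: Balaban1982Higgs2, Lemma 2.3 p.571] -/
theorem exists_lemma23Bounds (d L : ℕ) (hd : 1 ≤ d) (hL : Odd L ∧ 1 < L) {a : ℝ} (ha : 0 < a) {μ0sq : ℝ} (hμ : 0 < μ0sq)
    (ε₀ : ℝ) : ∃ δ C₁ C₂ : ℝ, 0 < δ ∧ 0 < C₁ ∧ 0 < C₂ ∧ Lemma23Bounds d L a μ0sq ε₀ δ C₁ C₂ :=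
  lemma23_higgsLattice d L d hd hL ha hμ ε₀

/-- `|v_μ − w_μ| ≤ ‖v − w‖` in `ℝᵈ`. [folklore] [cite: Balaban1982Higgs1, (1.22) p.607] -/
private theorem abs_apply_sub_le {n : ℕ} (v w : EuclideanSpace ℝ (Fin n)) (μ : Fin n) : |v μ - w μ| ≤ ‖v - w‖ := by
  have h := PiLp.norm_apply_le (v - w) μ
  simpa [Real.norm_eq_abs] using h

/-- **LEMMA 2.3 IN THE GEN-10 THRESHOLD SHAPE, ONE LEVEL** (`1 ≤ k ≤ K`, `s = Lᵏε ≤ min(ε₀, 1)`): on a torus of the sub-family with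
`P.d = d`, `P.L = L`, given the Lemma-2.3 constants `(δ, C₁, C₂)` (`Lemma23Bounds`), `R ≥ 2/δ`, `r ≥ 1`, a (2.44)-cut-off `ζ^{(k)}` (radius
`r(s)`, plateau `½r(s)`), regions `Λ₂ ⊆ Λ₁ ⊂ T⁽ᵏ⁾` with the nbhd property, and a block vector field `A_k` obeying (2.55) on `Λ₁`
(`‖A_k(y′)‖ ≤ thrA(s)`, `‖A_k(y′) − A_k(y)‖ ≤ thrQ(s)(r₁ + r₂|y − y′|)`), the minimizer `A^{(k),ε} = ofSite(cutMin … (toSite A_k))` of (3.3)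
satisfies, at every fine point `x` over `Λ₂` and all directions `μ, ν`:
(2.59) `|A^{(k),ε}(⟨x,μ⟩) − A_k(⟨x_k,μ⟩)| ≤ thr259(s)` and (2.60) `|A^{(k),ε}(⟨x+εe_ν,μ⟩) − A^{(k),ε}(⟨x,μ⟩)| ≤ thr260(ε,s)` for the DERIVED
constants `c₃ = c3Of`, `c₅ = c5Of`. [cite: Balaban1982Higgs2, Lemma 2.3 (2.59)–(2.60) p.571, (3.3) p.583, (2.44) p.566, (2.7) p.558] -/
theorem lemma23_thresholds {d L : ℕ} {a ε₀ δ C₁ C₂ : ℝ} {Γ : MinConsts} (hΓ : Γ.Valid) (ha : 0 < a)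
    (pkg : Lemma23Bounds d L a Γ.μ0sq ε₀ δ C₁ C₂) (hδ : 0 < δ) (hC₂ : 0 ≤ C₂)
    {P : HiggsLattice.Params} (S : Shape P) (hPd : P.d = d) (hPL : P.L = L)
    {R r : ℝ} (hR : 2 / δ ≤ R) (hr : 1 ≤ r)
    {k : ℕ} (hk1 : 1 ≤ k) (hk : k ≤ P.K) (hs1 : P.mesh k ≤ 1) (hsε : P.mesh k ≤ ε₀)
    (ζ : HiggsLattice.Site P 0 → HiggsLattice.Site P k → ℝ)
    (habs : ∀ x y', |ζ x y'| ≤ 1)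
    (hsupp : ∀ x y', ζ x y' ≠ 0 → (HiggsLattice.Site.tdist (blockIter k x) y' : ℝ) ≤ B2.rFn R r (P.mesh k))
    (hone : ∀ x y', (HiggsLattice.Site.tdist (blockIter k x) y' : ℝ) ≤ B2.rFn R r (P.mesh k) / 2 → ζ x y' = 1)
    (hlip : ∀ (x : HiggsLattice.Site P 0) (ν : Fin P.d) (y' : HiggsLattice.Site P k),
      |ζ (x.shift ν) y' - ζ x y'| ≤ ((P.L : ℝ) ^ k)⁻¹)
    (Λ₁ Λ₂ : Finset (HiggsLattice.Site P k)) (hsub : Λ₂ ⊆ Λ₁)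
    (nbhd : ∀ x y', blockIter k x ∈ Λ₂ → (HiggsLattice.Site.tdist (blockIter k x) y' : ℝ) ≤ B2.rFn R r (P.mesh k) + 1 → y' ∈ Λ₁)
    (Ak : HiggsLattice.VecField P k)
    (hA : ∀ y' ∈ Λ₁, ‖toSite Ak y'‖ ≤ Γ.thrA P.d (P.mesh k))
    (hvar : ∀ y ∈ Λ₂, ∀ y' ∈ Λ₁,
      ‖toSite Ak y' - toSite Ak y‖ ≤ Γ.thrQ P.d (P.mesh k) * (Γ.r₁ + Γ.r₂ * (HiggsLattice.Site.tdist y y' : ℝ)))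
    (x : HiggsLattice.Site P 0) (hx : blockIter k x ∈ Λ₂) (μ ν : Fin P.d) :
    |ofSite (cutMin (zeroCharge P.d) Γ.μ0sq a k ζ (toSite Ak)) ⟨x, μ⟩ - Ak ⟨blockIter k x, μ⟩|
        ≤ thr259 (Γ.toConsts (Γ.c3Of a L C₁ C₂) (Γ.c5Of C₁ C₂)) P.d (P.mesh k)
    ∧ |ofSite (cutMin (zeroCharge P.d) Γ.μ0sq a k ζ (toSite Ak)) ⟨x.shift ν, μ⟩
        - ofSite (cutMin (zeroCharge P.d) Γ.μ0sq a k ζ (toSite Ak)) ⟨x, μ⟩|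
        ≤ thr260 (Γ.toConsts (Γ.c3Of a L C₁ C₂) (Γ.c5Of C₁ C₂)) P.d P.ε (P.mesh k) := by
  subst hPd hPL
  have hs : 0 < P.mesh k := P.mesh_pos k
  have hLr : (1 : ℝ) < P.L := by exact_mod_cast S.hL.2
  have hp : 0 ≤ B2.pFn Γ.b₀ Γ.p (P.mesh k) :=
    pFn_nonneg' (Γ := Γ.toConsts 0 0) (MinConsts.toConsts_valid hΓ le_rfl le_rfl) hs hs1
  have hq : 0 ≤ Γ.thrQ P.d (P.mesh k) := by
    unfold MinConsts.thrQ; have := hΓ.cq_nonneg; positivity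
  have hρ₁ : 0 ≤ B2.rFn R r (P.mesh k) / 2 := by
    have hRpos : 0 < R := lt_of_lt_of_le (by positivity) hR
    have hu : 1 ≤ 1 + Real.log (P.mesh k)⁻¹ := one_le_u hs hs1
    have h0 : 0 ≤ (1 + Real.log (P.mesh k)⁻¹) ^ r := Real.rpow_nonneg (by linarith) _
    unfold B2.rFn
    exact div_nonneg (mul_nonneg hRpos.le h0) (by norm_num)
  obtain ⟨h59, h60⟩ := pkg P S rfl rfl (zeroCharge P.d) hk1 hk hsε ζ (B2.rFn R r (P.mesh k))
    (B2.rFn R r (P.mesh k) / 2) hρ₁ habs hsupp hone hlip Λ₁ Λ₂ hsub nbhd (toSite Ak) (Γ.thrA P.d (P.mesh k))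
    (Γ.thrQ P.d (P.mesh k)) Γ.r₁ Γ.r₂ hq hΓ.r₁_nonneg hΓ.r₂_nonneg hA hvar x hx
  have hE : Real.exp (-(δ * (B2.rFn R r (P.mesh k) / 2))) ≤ P.mesh k := exp_neg_delta_rho_le hs hs1 hδ hR hr
  have hak : a * (1 - ((P.L : ℝ) ^ 2)⁻¹) < B1.aSeq a P.L k := B1.ainf_lt_aSeq ha hLr k hk1
  set M : HiggsLattice.ScalarField P 0 P.d := cutMin (zeroCharge P.d) Γ.μ0sq a k ζ (toSite Ak)
  refine ⟨?_, ?_⟩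
  · -- (2.59): component `μ` of r14's vector bound, then the arithmetic
    have hcomp : |ofSite M ⟨x, μ⟩ - Ak ⟨blockIter k x, μ⟩| ≤ ‖M x - toSite Ak (blockIter k x)‖ := by
      have h := abs_apply_sub_le (M x) (toSite Ak (blockIter k x)) μ
      exact h
    refine hcomp.trans (h59.trans ?_)
    exact bound259_le_thr259 hΓ ha S.hL.2 hC₂ P.d hs hs1 hE hak _
  · -- (2.60)
    have hcomp : |ofSite M ⟨x.shift ν, μ⟩ - ofSite M ⟨x, μ⟩| ≤ ‖M (x.shift ν) - M x‖ :=
      abs_apply_sub_le (M (x.shift ν)) (M x) μ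
    refine hcomp.trans ((h60 ν).trans ?_)
    exact bound260_le_thr260 hΓ hC₂ P.d P.hε.le hs hs1 rfl hE _

/-! ## §4 The carrier with the PRINTED minimizers and the PRINTED restrictions; the map to the gen-10 carrier -/

/-- **One instance of Proposition 3.1 with the (3.3) minimizers and the (2.55) restrictions**: the data of p23 g10's `RMultiP` (lattice
member of the torus sub-family, steps `K`, stopping rule, tower of regions, charge data, cut-offs `θ_k` with their printed properties,
`A₀`, block vector fields `A_k`, configuration `Φ`) WITHOUT the minimizers — which are DEFINED below by (3.3) from the (2.44)-cut-offs
`ζ^{(k)}` (data: kernel, with `|ζ| ≤ 1`, support radius `r(Lᵏε)`, plateau `½r(Lᵏε)`, Lipschitz `L^{−k}` per fine step) — together with,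
per level, the regions `Λ₂-region ⊆ Λ₁-region ⊂ T⁽ᵏ⁾` on which (2.55) is imposed / (2.59) is needed: `Λ₅⁽ᵏ⁻¹⁾′ ⊆ Λ₂-region` (print:
`Λ₅ ⊂ Λ₂`), the `θ_{k+1}`-slice within `Bᵏ⁺¹(Λ₂-region)`, and the range of `ζ^{(k)}` (+1) around `Bᵏ(Λ₂-region)` inside the `Λ₁`-region
((2.8): the `Λ_i` are `r`-separated). [cite: Balaban1982Higgs2, Prop. 3.1 p.589, (3.2)–(3.3) p.583, (2.44) p.566, (2.55) p.570, (2.8) p.558] -/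
structure RMultiM (Q : B2.Params) (Γ : MinConsts) (m2 : ℝ) where
  /-- the lattice family member (tori `T^{(k)}_{Lᵏε}`) -/
  P : HiggsLattice.Params
  hL : P.L = Q.L
  hd : P.d = Q.d
  /-- the torus sub-family `M·L′_μ = Lᵐ`, `L` odd (r14's/p14's decay bounds) -/
  S : Shape P
  /-- number of real scalar-field components -/
  N : ℕ
  /-- number of renormalization steps -/
  K : ℕ
  hK : K ≤ P.K
  /-- the stopping rule `Lᴷε ≤ ε₀` (p. 582) -/
  hε₀ : P.mesh K ≤ Γ.ε₀
  /-- the tower of large-field regions `Λ₅⁽ᵏ⁾` -/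
  T : Tower P K
  C : ChargeData N
  /-- the model's coupling constant -/
  hCe : C.e = Γ.e
  /-- the cut-offs `θ_k` on the fine torus, with their printed properties (as in `RMultiP`) -/
  θ : ℕ → HiggsLattice.Site P 0 → ℝ
  θ_nested : Nested θ
  θ_range : ∀ m (z : HiggsLattice.Site P 0), 0 ≤ θ m z ∧ θ m z ≤ 1
  θ_one : ∀ k, 1 ≤ k → k ≤ K → ∀ z : HiggsLattice.Site P 0, T.lamAt (k - 1) z → θ k z = 1 ∧ ∀ ν, θ k (z.shift ν) = 1
  θ_zero : ∀ k, k + 2 ≤ K → ∀ z : HiggsLattice.Site P 0,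
    (θ (k + 2) z ≠ 0 ∨ ∃ ν, θ (k + 2) (z.shift ν) ≠ 0) → T.lamAt k z
  θ_above : ∀ m, K < m → ∀ z : HiggsLattice.Site P 0, θ m z = 0
  θ_lip : ∀ k (z : HiggsLattice.Site P 0) (ν : Fin P.d), |θ (k + 1) (z.shift ν) - θ (k + 1) z| ≤ Γ.cθ * ((P.L : ℝ) ^ k)⁻¹
  /-- `A₀` of (3.2) -/
  A₀ : HiggsLattice.VecField P 0
  /-- the block vector fields `A_k` on `T⁽ᵏ⁾` -/
  Ac : (k : ℕ) → HiggsLattice.VecField P k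
  /-- the configuration `Φ` of (3.24) -/
  Φ : Cfg T.regions N
  /-- the cut-offs `ζ^{(k)}(x, y′)` of (2.44), `y′` a block label of `T⁽ᵏ⁾` -/
  ζ : (k : ℕ) → HiggsLattice.Site P 0 → HiggsLattice.Site P k → ℝ
  ζ_abs : ∀ k x y', |ζ k x y'| ≤ 1
  /-- support radius `r(Lᵏε)` (print: `< r(Lᵏε) − 2M`) -/
  ζ_supp : ∀ k x y', ζ k x y' ≠ 0 → (HiggsLattice.Site.tdist (blockIter k x) y' : ℝ) ≤ B2.rFn Q.R Q.r (P.mesh k)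
  /-- plateau radius `½r(Lᵏε)` -/
  ζ_one : ∀ k x y', (HiggsLattice.Site.tdist (blockIter k x) y' : ℝ) ≤ B2.rFn Q.R Q.r (P.mesh k) / 2 → ζ k x y' = 1
  /-- *"|(∂^η_xζ^{(k)})(b, y)| ≦ 1"*: Lipschitz `L^{−k}` per fine step -/
  ζ_lip : ∀ k (x : HiggsLattice.Site P 0) (ν : Fin P.d) (y' : HiggsLattice.Site P k),
    |ζ k (x.shift ν) y' - ζ k x y'| ≤ ((P.L : ℝ) ^ k)⁻¹
  /-- the `Λ₁`-region of level `k` (print: `Λ₋₁⁽ᵏ⁻¹⁾′`), where (2.55) holds -/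
  L1 : (k : ℕ) → Finset (HiggsLattice.Site P k)
  /-- the `Λ₂`-region of level `k` (print: `Λ₂⁽ᵏ⁻¹⁾′`), over which (2.59)/(2.60) are used -/
  L2 : (k : ℕ) → Finset (HiggsLattice.Site P k)
  L2_sub : ∀ k, L2 k ⊆ L1 k
  /-- the range of `ζ^{(k)}` (+1) around `Bᵏ(Λ₂-region)` lies in the `Λ₁`-region -/
  nbhd : ∀ k x y', blockIter k x ∈ L2 k →
    (HiggsLattice.Site.tdist (blockIter k x) y' : ℝ) ≤ B2.rFn Q.R Q.r (P.mesh k) + 1 → y' ∈ L1 k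
  /-- `Λ₅⁽ʲ⁾′ ⊆ Λ₂-region of level j + 1` (print: `Λ₅ ⊂ Λ₂`) -/
  lam_sub : ∀ j, j < K → B2Eq324NestedRegions.prime (T.lam j) ⊆ L2 (j + 1)
  /-- the `θ_{j+2}`-slice lies within `Bʲ⁺²(Λ₂-region of level j + 2)` -/
  slice_sub : ∀ j (z : HiggsLattice.Site P 0) (ν : Fin P.d),
    (θ (j + 2) z ≠ 0 ∨ θ (j + 2) (z.shift ν) ≠ 0) → blockIter (j + 2) z ∈ L2 (j + 2)

namespace RMultiM

variable {Q : B2.Params} {Γ : MinConsts} {m2 : ℝ}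

/-- **THE MINIMIZERS (3.3) OF THE INSTANCE**: `A^{(k),ε} = a_k(Lᵏε)^{−2}ζ^{(k)}G^ε_kQ*_kA_k` — r14's `cutMin` at the trivial coupling
(the vector-field case, `N = d`), read back as a bond function. [cite: Balaban1982Higgs2, (3.3) p.583] -/
def A (i : RMultiM Q Γ m2) (k : ℕ) : HiggsLattice.VecField i.P 0 :=
  ofSite (cutMin (zeroCharge i.P.d) Γ.μ0sq Q.a k (i.ζ k) (toSite (i.Ac k)))

/-- Pointwise: `A^{(k),ε}(⟨x, μ⟩) = (cutMin … (toSite A_k))(x)_μ` (definitional). [cite: Balaban1982Higgs2, (3.3) p.583] -/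
theorem A_apply (i : RMultiM Q Γ m2) (k : ℕ) (x : HiggsLattice.Site i.P 0) (μ : Fin i.P.d) :
    i.A k ⟨x, μ⟩ = cutMin (zeroCharge i.P.d) Γ.μ0sq Q.a k (i.ζ k) (toSite (i.Ac k)) x μ := rfl

/-- **The field `Ã^ε` of the instance**: (3.2) built from the cut-offs, `A₀` and the (3.3) minimizers. [cite: Balaban1982Higgs2, (3.2) p.583] -/
def field (i : RMultiM Q Γ m2) : HiggsLattice.VecField i.P 0 := field32 i.θ i.A₀ i.A i.K

/-- **The map to the gen-10 carrier**: the same data, the minimizers SUPPLIED by (3.3); the gen-10 constants with any `c₃`, `c₅`.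
[cite: Balaban1982Higgs2, Prop. 3.1 p.589] -/
def toRMultiP (i : RMultiM Q Γ m2) (c₃ c₅ : ℝ) : RMultiP Q (Γ.toConsts c₃ c₅) m2 where
  P := i.P
  hL := i.hL
  hd := i.hd
  N := i.N
  K := i.K
  hK := i.hK
  hε₀ := i.hε₀
  T := i.T
  C := i.C
  hCe := i.hCe
  θ := i.θ
  θ_nested := i.θ_nested
  θ_range := i.θ_range
  θ_one := i.θ_one
  θ_zero := i.θ_zero
  θ_above := i.θ_above
  θ_lip := i.θ_lip
  A₀ := i.A₀
  A := i.A
  Ac := i.Ac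
  Φ := i.Φ

/-- The image has the same field `Ã^ε` (definitional). [cite: Balaban1982Higgs2, (3.2) p.583] -/
theorem toRMultiP_field (i : RMultiM Q Γ m2) (c₃ c₅ : ℝ) : (i.toRMultiP c₃ c₅).field = i.field := rfl

/-- **THE PRINTED RESTRICTIONS ON THE BLOCK FIELDS** (the content of the characteristic functions `χ_k` of (3.21)): for every level
`1 ≤ k ≤ K`, (2.55)₂ `‖A_k(y′)‖ ≤ c_{A1}·s_k^{−d/2}p(s_k)` on the `Λ₁`-region and (2.55)₁ (integrated) `‖A_k(y′) − A_k(y)‖ ≤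
c_q·s_k^{−(d−2)/2}p(s_k)·(r₁ + r₂|y − y′|)` for `y` in the `Λ₂`-region, `y′` in the `Λ₁`-region; the restriction (2.17)/(2.97) on
`A_{k+1}(z_{k+1}) − A_k(z_k)` on the `θ_{k+1}`-slice over `Bᵏ(Λ_k)`; and (2.55)₄/(3.15)₂ `‖φ_k(y)‖ ≤ thrφ(s_k)` on `Λ_k`.  NO minimizer, NO
(2.59)/(2.60) is assumed. [cite: Balaban1982Higgs2, Prop. 3.1 p.589, (3.21) p.588, (2.55) p.570, (2.17) p.560, (3.15) p.586] -/
def restrictedM (i : RMultiM Q Γ m2) : Prop :=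
  (∀ k, 1 ≤ k → k ≤ i.K → ∀ y' ∈ i.L1 k, ‖toSite (i.Ac k) y'‖ ≤ Γ.thrA i.P.d (i.P.mesh k))
  ∧ (∀ k, 1 ≤ k → k ≤ i.K → ∀ y ∈ i.L2 k, ∀ y' ∈ i.L1 k,
      ‖toSite (i.Ac k) y' - toSite (i.Ac k) y‖
        ≤ Γ.thrQ i.P.d (i.P.mesh k) * (Γ.r₁ + Γ.r₂ * (HiggsLattice.Site.tdist y y' : ℝ)))
  ∧ (∀ (j : Fin i.K), ∀ z ∈ pieceF i.T.regions j, ∀ μ ν : Fin i.P.d,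
      (i.θ (j.val + 2) z ≠ 0 ∨ i.θ (j.val + 2) (z.shift ν) ≠ 0) →
      |i.Ac (j.val + 2) ⟨blockIter (j.val + 2) z, μ⟩ - i.Ac (j.val + 1) ⟨blockIter (j.val + 1) z, μ⟩|
        ≤ Γ.thr217M i.P.d (i.P.mesh (j.val + 1)))
  ∧ (∀ (j : Fin i.K) (y : LSite i.T.regions j), ‖resL i.T.regions j i.Φ y‖ ≤ Γ.thrφM i.P.d (i.P.mesh (j.val + 1)))

/-- `s_k ≤ ε₀ ≤ 1` for `k ≤ K`. [cite: Balaban1982Higgs2, p.582] -/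
theorem mesh_le_eps0 (hΓ : Γ.Valid) (i : RMultiM Q Γ m2) {k : ℕ} (hk : k ≤ i.K) : i.P.mesh k ≤ Γ.ε₀ ∧ i.P.mesh k ≤ 1 :=
  ⟨(mesh_le_mesh hk).trans i.hε₀, ((mesh_le_mesh hk).trans i.hε₀).trans hΓ.ε₀_le_one⟩

/-- A fine point of `Bᵏ(Λ_k)` (`k = j + 1`) has its `k`-block label in `Λ₅⁽ʲ⁾′ ⊆ Λ₂-region of level k`.
[cite: Balaban1982Higgs2, (3.22)–(3.24) p.588] -/
theorem blockIter_mem_L2_of_mem_pieceF (i : RMultiM Q Γ m2) (j : Fin i.K) {z : HiggsLattice.Site i.P 0}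
    (hz : z ∈ pieceF i.T.regions j) : blockIter (j.val + 1) z ∈ i.L2 (j.val + 1) := by
  have h2 : blockIter (j.val + 1) z ∈ B2Eq324NestedRegions.prime (i.T.lam j.val) \ i.T.lam (j.val + 1) :=
    (mem_pieceF_iff i.T.regions j z).mp hz
  exact i.lam_sub j.val j.isLt (Finset.mem_sdiff.mp h2).1

/-- **THE PRINTED RESTRICTIONS IMPLY THE GEN-10 RESTRICTIONS** for the image instance, given Lemma-2.3 constants `(δ, C₁, C₂)` for
`(d, L, a, μ₀², ε₀) = (Q.d, Q.L, Q.a, μ₀², ε₀)`, `Q.R ≥ 2/δ`, `Q.r ≥ 1`: all six conjuncts of `RMultiP.restricted` — (2.60)_k, (2.59)_k on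
`Bᵏ(Λ_k)`, the two slice conjuncts at level `k + 1`, (2.17), (2.55)₄ — with `c₃ = c3Of`, `c₅ = c5Of` (`lemma23_thresholds` at the levels
`k` and `k + 1`; (2.17) and (2.55)₄ carried over). [cite: Balaban1982Higgs2, Prop. 3.1 p.589, Lemma 2.3 p.571, (2.97)–(2.98) p.577] -/
theorem restricted_toRMultiP (hΓ : Γ.Valid) (hQa : 0 < Q.a) {δ C₁ C₂ : ℝ}
    (pkg : Lemma23Bounds Q.d Q.L Q.a Γ.μ0sq Γ.ε₀ δ C₁ C₂) (hδ : 0 < δ) (hC₂ : 0 ≤ C₂)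
    (hR : 2 / δ ≤ Q.R) (hr : 1 ≤ Q.r) (i : RMultiM Q Γ m2) (hrM : i.restrictedM) :
    (i.toRMultiP (Γ.c3Of Q.a Q.L C₁ C₂) (Γ.c5Of C₁ C₂)).restricted := by
  obtain ⟨hsup, hvar, h217, hΦ⟩ := hrM
  -- the one-level lemma at the levels `k ≤ K` of the instance
  have key : ∀ {k : ℕ}, 1 ≤ k → k ≤ i.K → ∀ (x : HiggsLattice.Site i.P 0), blockIter k x ∈ i.L2 k → ∀ μ ν : Fin i.P.d,
      |i.A k ⟨x, μ⟩ - i.Ac k ⟨blockIter k x, μ⟩|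
          ≤ thr259 (Γ.toConsts (Γ.c3Of Q.a Q.L C₁ C₂) (Γ.c5Of C₁ C₂)) i.P.d (i.P.mesh k)
      ∧ |i.A k ⟨x.shift ν, μ⟩ - i.A k ⟨x, μ⟩|
          ≤ thr260 (Γ.toConsts (Γ.c3Of Q.a Q.L C₁ C₂) (Γ.c5Of C₁ C₂)) i.P.d i.P.ε (i.P.mesh k) := by
    intro k hk1 hk x hx μ ν
    have hm := i.mesh_le_eps0 hΓ hk
    exact lemma23_thresholds hΓ hQa pkg hδ hC₂ i.S i.hd i.hL hR hr hk1 (hk.trans i.hK) hm.2 hm.1 (i.ζ k) (i.ζ_abs k)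
      (i.ζ_supp k) (i.ζ_one k) (i.ζ_lip k) (i.L1 k) (i.L2 k) (i.L2_sub k) (i.nbhd k) (i.Ac k) (hsup k hk1 hk) (hvar k hk1 hk)
      x hx μ ν
  -- the slice at `j` forces `j + 2 ≤ K` (`θ_m = 0` above `K`)
  have hsl_le : ∀ (j : ℕ) (z : HiggsLattice.Site i.P 0) (ν : Fin i.P.d),
      (i.θ (j + 2) z ≠ 0 ∨ i.θ (j + 2) (z.shift ν) ≠ 0) → j + 2 ≤ i.K := by
    intro j z ν hsl
    by_contra hK
    have h0 := i.θ_above (j + 2) (by omega)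
    rcases hsl with h | h
    · exact h (h0 z)
    · exact h (h0 (z.shift ν))
  refine ⟨?_, ?_, ?_, ?_, ?_, ?_⟩
  · -- (2.60)_k on `Bᵏ(Λ_k)`
    intro j z hz μ ν
    have hj : j.val < i.K := j.isLt
    exact (key (k := j.val + 1) (by omega) (by omega) z (i.blockIter_mem_L2_of_mem_pieceF j hz) μ ν).2
  · -- (2.59)_k on `Bᵏ(Λ_k)`
    intro j z hz μ
    have hj : j.val < i.K := j.isLt
    exact (key (k := j.val + 1) (by omega) (by omega) z (i.blockIter_mem_L2_of_mem_pieceF j hz) μ μ).1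
  · -- (2.60)_{k+1} on the slice
    intro j z hz μ ν hsl
    have hsl' : i.θ (j.val + 2) z ≠ 0 ∨ i.θ (j.val + 2) (z.shift ν) ≠ 0 := hsl
    exact (key (k := j.val + 2) (by omega) (hsl_le j.val z ν hsl') z (i.slice_sub j.val z ν hsl') μ ν).2
  · -- (2.59)_{k+1} on the slice
    intro j z hz μ ν hsl
    have hsl' : i.θ (j.val + 2) z ≠ 0 ∨ i.θ (j.val + 2) (z.shift ν) ≠ 0 := hsl
    exact (key (k := j.val + 2) (by omega) (hsl_le j.val z ν hsl') z (i.slice_sub j.val z ν hsl') μ ν).1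
  · -- (2.17) (carried over; `thr217` does not read `c₃`, `c₅`)
    intro j z hz μ ν hsl
    have hsl' : i.θ (j.val + 2) z ≠ 0 ∨ i.θ (j.val + 2) (z.shift ν) ≠ 0 := hsl
    have hz' : z ∈ pieceF i.T.regions j := hz
    rw [MinConsts.thr217_toConsts]
    exact h217 j z hz' μ ν hsl'
  · -- (2.55)₄ (carried over)
    intro j y
    rw [MinConsts.thrφ_toConsts]
    exact hΦ j y

end RMultiM

/-! ## §5 The families and Proposition 3.1 / (3.29) for them -/

/-- **THE FAMILY OF `B2.P31Setting` WITH THE (3.3) MINIMIZERS OVER THE (2.55) RESTRICTIONS**: `restricted := restrictedM`; all other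
fields as in gen 10's `printedP31Fam` for the image instance (`ε`, `K`, `zeroField := (Ã^ε = 0)`, `form = ⟨Φ, Δ(Ã^ε)Φ⟩`, `formN`, `term`,
`bond`, `mass`, `vol`). [cite: Balaban1982Higgs2, Prop. 3.1 (3.26)–(3.28) p.589] -/
def minP31Fam (Q : B2.Params) (Γ : MinConsts) (m2 : ℝ) (i : RMultiM Q Γ m2) : B2.P31Setting :=
  { printedP31Fam Q (Γ.toConsts 0 0) m2 (i.toRMultiP 0 0) with restricted := i.restrictedM }

/-- The numeric fields of `minP31Fam` are those of `printedP31Fam` at the image instance, for ANY `c₃`, `c₅` (definitional).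
[cite: Balaban1982Higgs2, Prop. 3.1 p.589] -/
theorem minP31Fam_eq (Q : B2.Params) (Γ : MinConsts) (m2 : ℝ) (i : RMultiM Q Γ m2) (c₃ c₅ : ℝ) :
    minP31Fam Q Γ m2 i = { printedP31Fam Q (Γ.toConsts c₃ c₅) m2 (i.toRMultiP c₃ c₅) with restricted := i.restrictedM } := rfl

/-- **THE PER-SCALE (3.29) FAMILY WITH THE (3.3) MINIMIZERS OVER THE (2.55) RESTRICTIONS** (`restricted := restrictedM`; the other fields
as in gen 10's `printed329Fam`). [cite: Balaban1982Higgs2, (3.29) p.590] -/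
def min329Fam (Q : B2.Params) (Γ : MinConsts) (m2 : ℝ) (ij : Σ i : RMultiM Q Γ m2, Fin i.K) : B2.I329Setting :=
  { printed329Fam Q (Γ.toConsts 0 0) m2 ⟨ij.1.toRMultiP 0 0, ij.2⟩ with restricted := ij.1.restrictedM }

/-- **PROPOSITION 3.1 (3.26) FOR THE FAMILY WITH THE PRINTED MINIMIZERS AND THE PRINTED RESTRICTIONS.**  For `d ∈ {2, 3}`, odd
`L > 1`, `a > 0`, `μ₀² > 0`, `0 < ε₀ ≤ 1` there are `R₀ > 0` (*"R > R₀"* of (2.7)) and O(1)'s `c₃, c₅ ≥ 0` — functions of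
`(d, L, a, μ₀², ε₀)` and of the O(1)'s of (2.55) — such that for every parameter record `Q` with `Q.d = d`, `Q.L = L`, `Q.a = a`, `Q.R ≥ R₀`,
`Q.r ≥ 1`, `Q.κ₀ < 2 − d/2`, every valid constants record `Γ` with `Γ.μ0sq = μ₀²`, `Γ.ε₀ = ε₀` whose coupling `e` is small in the sense
`SmallEps d L (Γ.toConsts c₃ c₅)` (*"e(Lᵏε) sufficiently small"*), and every `m² > 0`, the cell's typed `B2.Prop31Printed Q` HOLDS on
`minP31Fam Q Γ m²` — both conjuncts: every instance whose block fields obey (2.55)/(2.17)/(2.55)₄ satisfies (3.26), its minimizers BEING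
(3.3) (`restricted_toRMultiP` + gen 10's `prop31Printed_thresholds`), and every instance with `Ã^ε = 0` satisfies it without the error and
without restrictions. [cite: Balaban1982Higgs2, Prop. 3.1 (3.26) p.589, Lemma 2.3 p.571, (3.3) p.583, (2.7) p.558] -/
theorem prop31Printed_minimizers (d L : ℕ) (hd2 : 2 ≤ d) (hd3 : d ≤ 3) (hL : Odd L ∧ 1 < L) {a : ℝ} (ha : 0 < a)
    {μ0sq : ℝ} (hμ : 0 < μ0sq) (ε₀ : ℝ) (Γ : MinConsts) (hΓ : Γ.Valid) (hΓμ : Γ.μ0sq = μ0sq) (hΓε : Γ.ε₀ = ε₀) :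
    ∃ R₀ c₃ c₅ : ℝ, 0 < R₀ ∧ 0 ≤ c₃ ∧ 0 ≤ c₅ ∧
      ∀ (Q : B2.Params), Q.d = d → Q.L = L → Q.a = a → R₀ ≤ Q.R → 1 ≤ Q.r → Q.κ₀ < 2 - (d : ℝ) / 2 →
        SmallEps d L (Γ.toConsts c₃ c₅) → ∀ {m2 : ℝ}, 0 < m2 → B2.Prop31Printed Q (minP31Fam Q Γ m2) := by
  obtain ⟨δ, C₁, C₂, hδ, hC₁, hC₂, pkg⟩ := exists_lemma23Bounds d L (by omega) hL ha hμ ε₀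
  refine ⟨2 / δ, Γ.c3Of a L C₁ C₂, Γ.c5Of C₁ C₂, by positivity, MinConsts.c3Of_nonneg hΓ ha hL.2 hC₁.le hC₂.le,
    MinConsts.c5Of_nonneg hΓ hC₁.le hC₂.le, ?_⟩
  intro Q hQd hQL hQa hR hRr hκ hsm m2 hm
  subst hQd hQL hQa hΓμ hΓε
  have hΓ'v : (Γ.toConsts (Γ.c3Of Q.a Q.L C₁ C₂) (Γ.c5Of C₁ C₂)).Valid :=
    MinConsts.toConsts_valid hΓ (MinConsts.c3Of_nonneg hΓ ha hL.2 hC₁.le hC₂.le) (MinConsts.c5Of_nonneg hΓ hC₁.le hC₂.le)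
  obtain ⟨γ₀, Cc, hγ, hCc, h1, h2⟩ := prop31Printed_thresholds Q hL.2 ha hd2 hd3 hκ _ hΓ'v hsm hm
  refine ⟨γ₀, Cc, hγ, hCc, fun i hri => ?_, fun i hz => ?_⟩
  · exact h1 (i.toRMultiP (Γ.c3Of Q.a Q.L C₁ C₂) (Γ.c5Of C₁ C₂))
      (RMultiM.restricted_toRMultiP hΓ ha pkg hδ hC₂.le hR hRr i hri)
  · exact h2 (i.toRMultiP (Γ.c3Of Q.a Q.L C₁ C₂) (Γ.c5Of C₁ C₂)) hz

/-- **THE CELL'S TYPED (3.29) FOR THE PER-SCALE FAMILY WITH THE PRINTED MINIMIZERS AND RESTRICTIONS** (same constants; `m² ≥ 0`):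
`B2.Ineq329Printed Q.κ₀ (min329Fam Q Γ m²)`. [cite: Balaban1982Higgs2, (3.29) p.590] -/
theorem ineq329Printed_minimizers (d L : ℕ) (hd2 : 2 ≤ d) (hd3 : d ≤ 3) (hL : Odd L ∧ 1 < L) {a : ℝ} (ha : 0 < a)
    {μ0sq : ℝ} (hμ : 0 < μ0sq) (ε₀ : ℝ) (Γ : MinConsts) (hΓ : Γ.Valid) (hΓμ : Γ.μ0sq = μ0sq) (hΓε : Γ.ε₀ = ε₀) :
    ∃ R₀ c₃ c₅ : ℝ, 0 < R₀ ∧ 0 ≤ c₃ ∧ 0 ≤ c₅ ∧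
      ∀ (Q : B2.Params), Q.d = d → Q.L = L → Q.a = a → R₀ ≤ Q.R → 1 ≤ Q.r → Q.κ₀ < 2 - (d : ℝ) / 2 →
        SmallEps d L (Γ.toConsts c₃ c₅) → ∀ {m2 : ℝ}, 0 ≤ m2 → B2.Ineq329Printed Q.κ₀ (min329Fam Q Γ m2) := by
  obtain ⟨δ, C₁, C₂, hδ, hC₁, hC₂, pkg⟩ := exists_lemma23Bounds d L (by omega) hL ha hμ ε₀
  refine ⟨2 / δ, Γ.c3Of a L C₁ C₂, Γ.c5Of C₁ C₂, by positivity, MinConsts.c3Of_nonneg hΓ ha hL.2 hC₁.le hC₂.le,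
    MinConsts.c5Of_nonneg hΓ hC₁.le hC₂.le, ?_⟩
  intro Q hQd hQL hQa hR hRr hκ hsm m2 hm
  subst hQd hQL hQa hΓμ hΓε
  have hΓ'v : (Γ.toConsts (Γ.c3Of Q.a Q.L C₁ C₂) (Γ.c5Of C₁ C₂)).Valid :=
    MinConsts.toConsts_valid hΓ (MinConsts.c3Of_nonneg hΓ ha hL.2 hC₁.le hC₂.le) (MinConsts.c5Of_nonneg hΓ hC₁.le hC₂.le)
  obtain ⟨γ₀, Cc, hγ, hCc, h1⟩ := ineq329Printed_thresholds Q hL.2 ha hd2 hd3 hκ _ hΓ'v hsm hm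
  refine ⟨γ₀, Cc, hγ, hCc, fun ij hri => ?_⟩
  obtain ⟨i, j⟩ := ij
  exact h1 ⟨i.toRMultiP (Γ.c3Of Q.a Q.L C₁ C₂) (Γ.c5Of C₁ C₂), j⟩
    (RMultiM.restricted_toRMultiP hΓ ha pkg hδ hC₂.le hR hRr i hri)

end Literature.MathematicalPhysics.QuantumFieldTheory.Balaban1983to89.B2Prop31MinimizerFamily

end
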